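import Mathlib.FieldTheory.SeparablyGenerated
import Mathlib.FieldTheory.Perfect
import Mathlib.FieldTheory.KummerPolynomial
import Mathlib.FieldTheory.IntermediateField.Adjoin.Algebra
import Mathlib.RingTheory.Valuation.ValuationSubring
import HarnessLib

/-!
# A separating transcendence basis containing a non-`p`-th power
# (stmt-ResolutionOfSingularities-16088, line `birth`, branch DiscreteRange, S1 `stub_dr_sepBasis`)

Let `k` be a perfect field of characteristic `p`, `K / k` a finitely generated field extension,
`O ⊆ K` a valuation ring and `t ∈ K` an element which is NOT a `p`-th power in `K` (in the branch:
a uniformizer of the discrete valuation ring `O`). Then there is a finite set `s ⊆ O` with `t ∉ s`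
such that `{t} ∪ s` is a SEPARATING transcendence basis of `K / k`: it is algebraically independent
over `k` and `K` is separable algebraic over `k(t, s)`.

Proof. Put `k' := k(t)`. By Mac Lane's criterion in the form proved in Mathlib
(`exists_isTranscendenceBasis_and_isSeparable_of_linearIndepOn_pow'`, the exchange lemma behind
Stacks 0H71 / 030W), `K / k'` is separably generated as soon as `k'`-linearly independent finite
families of `K` have `k'`-linearly independent `p`-th powers. For `k' = k(t)` with `k` perfect this
says exactly that `t ∉ K^p`: every element of `k(t)` is a `k(t)^p`-combination of
`1, t, …, t^{p-1}` (`exists_eq_sum_pow_mul_pow`), and these powers are linearly independent over the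
field `K^p` of `p`-th powers because `X^p - t^p` is irreducible over `K^p`
(`eq_zero_of_sum_pow_mul_pow_eq_zero`). The maximality argument of Mathlib's
`exists_isTranscendenceBasis_and_isSeparable_of_linearIndepOn_pow_of_essFiniteType` is replayed
with the extra constraint that the basis lies in `O` (replace a witness `n ∉ O` of inseparability
by `n⁻¹ ∈ O`). Finally `t` is transcendental over `k` (an algebraic element over the perfect field
`k` generates a perfect subfield, so it would be a `p`-th power), hence `{t} ∪ s` is algebraically
independent over `k`, and `k(t)(s) = k(t, s)`. The hypotheses `k ⊆ O`, `t ∈ O` of the registered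
signature are standing hypotheses of the branch and are not needed for this step.

References: S. Mac Lane, *Modular fields I. Separating transcendence bases*, Duke Math. J. 5
(1939) 372–393; Stacks Project 0H71, 030W (Mathlib `Mathlib.FieldTheory.SeparablyGenerated`).
-/

noncomputable section

-- single-problem summit: the doubled namespace component `ResolutionOfSingularities` is forced
set_option linter.dupNamespace false

open IntermediateField Polynomial

namespace Summit.ResolutionOfSingularities.ResolutionOfSingularities.Theorems.IndSmoothBirth

/-! ## `1, t, …, t^{p-1}` over the field of `p`-th powers -/

/-- In a field of characteristic `p`, if `t` is not a `p`-th power then `1, t, …, t^{p-1}` are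
linearly independent over the subfield `K^p` of `p`-th powers: a relation
`∑_{j<p} t^j e_j^p = 0` forces every `e_j = 0` (the minimal polynomial of `t` over `K^p` is
`X^p - t^p`, irreducible since `t^p` is not a `p`-th power in `K^p`). [folklore] -/
theorem eq_zero_of_sum_pow_mul_pow_eq_zero {K : Type*} [Field K] {p : ℕ} (hp : p.Prime)
    [CharP K p] {t : K} (hnp : ∀ u : K, u ^ p ≠ t) (e : Fin p → K)
    (he : ∑ j : Fin p, t ^ (j : ℕ) * e j ^ p = 0) (j : Fin p) : e j = 0 := by
  haveI : ExpChar K p := ExpChar.prime hp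
  let Kp : Subfield K := (frobenius K p).fieldRange
  have hmem : ∀ x : K, x ^ p ∈ Kp := fun x => RingHom.mem_fieldRange.mpr ⟨x, frobenius_def ..⟩
  let a : Kp := ⟨t ^ p, hmem t⟩
  have ha : ∀ b : Kp, b ^ p ≠ a := by
    intro b hb
    obtain ⟨w, hw⟩ := RingHom.mem_fieldRange.mp b.2
    have hb' : ((b : K)) ^ p = t ^ p := by
      have h := congrArg Subtype.val hb
      simpa [a] using h
    have hbt : (b : K) = t := frobenius_inj K p hb'
    exact hnp w (by rw [← frobenius_def, hw, hbt])
  have hirr : Irreducible (X ^ p - C a) := X_pow_sub_C_irreducible_of_prime hp ha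
  have hmin : X ^ p - C a = minpoly Kp t :=
    minpoly.eq_of_irreducible_of_monic hirr
      (by simp only [map_sub, map_pow, aeval_X, aeval_C]; exact sub_self _)
      (monic_X_pow_sub_C a hp.ne_zero)
  let b : Fin p → Kp := fun i => ⟨e i ^ p, hmem (e i)⟩
  have hq : aeval t (∑ i : Fin p, C (b i) * X ^ (i : ℕ)) = 0 := by
    simp only [map_sum, map_mul, aeval_C, map_pow, aeval_X]
    rw [← he]
    refine Finset.sum_congr rfl fun i _ => ?_
    rw [mul_comm]
    rfl
  have hq0 : (∑ i : Fin p, C (b i) * X ^ (i : ℕ) : Kp[X]) = 0 := by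
    by_contra hne
    have h1 := minpoly.degree_le_of_ne_zero Kp t hne hq
    rw [← hmin, degree_X_pow_sub_C hp.pos] at h1
    exact absurd (degree_sum_fin_lt b) (not_lt.mpr h1)
  have hcoeff : (∑ i : Fin p, C (b i) * X ^ (i : ℕ) : Kp[X]).coeff j = b j := by
    rw [finsetSum_coeff]
    simp only [coeff_C_mul_X_pow]
    rw [Finset.sum_eq_single j]
    · simp
    · intro i _ hij
      rw [if_neg]
      exact fun h => hij (Fin.ext h).symm
    · intro h
      exact absurd (Finset.mem_univ j) h
  rw [hq0, coeff_zero] at hcoeff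
  have h0 : e j ^ p = 0 := by
    have h := congrArg Subtype.val hcoeff
    simpa [b] using h.symm
  exact pow_eq_zero_iff hp.ne_zero |>.mp h0

/-! ## `k(t) = k(t)^p [t]` for `k` perfect -/

/-- `x⁻¹ = x^{p-1} · (x⁻¹)^p` in any field (`p ≥ 1`). [folklore] -/
theorem inv_eq_pow_mul_inv_pow {K : Type*} [Field K] (x : K) {p : ℕ} (hp : 1 ≤ p) :
    x⁻¹ = x ^ (p - 1) * x⁻¹ ^ p := by
  obtain ⟨m, rfl⟩ := Nat.exists_eq_add_of_le' hp
  rw [Nat.add_sub_cancel]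
  rcases eq_or_ne x 0 with rfl | hx
  · simp
  · rw [pow_succ, ← mul_assoc, ← mul_pow, mul_inv_cancel₀ hx, one_pow, one_mul]

/-- Over a perfect field `k` of characteristic `p`, every element of `k(t)` is a `k(t)^p`-linear
combination of `1, t, …, t^{p-1}`: the set of such combinations contains `k = k^p` and `t`, and is
closed under sums, products (reduce `t^m` via `t^m = t^{m mod p} (t^{⌊m/p⌋})^p`) and inverses
(`x⁻¹ = x^{p-1} (x⁻¹)^p`). [folklore] -/
theorem exists_eq_sum_pow_mul_pow {k K : Type*} [Field k] [Field K] [Algebra k K] {p : ℕ}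
    (hp : p.Prime) [CharP k p] [PerfectField k] (t : K) {x : K} (hx : x ∈ k⟮t⟯) :
    ∃ d : Fin p → K, (∀ j, d j ∈ k⟮t⟯) ∧ x = ∑ j : Fin p, t ^ (j : ℕ) * d j ^ p := by
  haveI : ExpChar k p := ExpChar.prime hp
  haveI : CharP K p := charP_of_injective_algebraMap (algebraMap k K).injective p
  haveI : ExpChar K p := ExpChar.prime hp
  have ht : t ∈ k⟮t⟯ := mem_adjoin_simple_self k t
  -- `Q x`: `x` is a `k(t)^p`-combination of `1, t, …, t^{p-1}`
  set Q : K → Prop := fun x => ∃ d : Fin p → K, (∀ j, d j ∈ k⟮t⟯) ∧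
    x = ∑ j : Fin p, t ^ (j : ℕ) * d j ^ p with hQ
  have hmono : ∀ (m : ℕ) (e : K), e ∈ k⟮t⟯ → Q (t ^ m * e ^ p) := by
    intro m e he
    refine ⟨Pi.single ⟨m % p, Nat.mod_lt m hp.pos⟩ (t ^ (m / p) * e), fun i => ?_, ?_⟩
    · by_cases h : i = ⟨m % p, Nat.mod_lt m hp.pos⟩
      · subst h
        simpa using mul_mem (pow_mem ht _) he
      · simp [h]
    · rw [Finset.sum_eq_single ⟨m % p, Nat.mod_lt m hp.pos⟩]
      · simp only [Pi.single_eq_same]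
        conv_lhs => rw [← Nat.div_add_mod m p]
        rw [pow_add, pow_mul, mul_pow]
        ring
      · intro i _ hij
        simp [hij, hp.ne_zero]
      · simp
  have hadd : ∀ x y, Q x → Q y → Q (x + y) := by
    rintro x y ⟨d, hd, rfl⟩ ⟨d', hd', rfl⟩
    refine ⟨d + d', fun i => add_mem (hd i) (hd' i), ?_⟩
    rw [← Finset.sum_add_distrib]
    refine Finset.sum_congr rfl fun i _ => ?_
    rw [Pi.add_apply, add_pow_expChar, mul_add]
  have hsum : ∀ (S : Finset (Fin p)) (f : Fin p → K), (∀ i ∈ S, Q (f i)) → Q (∑ i ∈ S, f i) :=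
    fun S f hf => Finset.sum_induction f Q hadd ⟨0, fun _ => zero_mem _, by simp [hp.ne_zero]⟩ hf
  have hmul : ∀ x y, Q x → Q y → Q (x * y) := by
    rintro x y ⟨d, hd, rfl⟩ ⟨d', hd', rfl⟩
    rw [Finset.sum_mul_sum]
    refine hsum _ _ fun i _ => hsum _ _ fun j _ => ?_
    have h : t ^ (i : ℕ) * d i ^ p * (t ^ (j : ℕ) * d' j ^ p) =
        t ^ ((i : ℕ) + j) * (d i * d' j) ^ p := by ring
    rw [h]
    exact hmono _ _ (mul_mem (hd i) (hd' j))
  have hscale : ∀ x e, e ∈ k⟮t⟯ → Q x → Q (x * e ^ p) := by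
    rintro x e he ⟨d, hd, rfl⟩
    refine ⟨fun i => d i * e, fun i => mul_mem (hd i) he, ?_⟩
    rw [Finset.sum_mul]
    refine Finset.sum_congr rfl fun i _ => ?_
    rw [mul_pow]
    ring
  have hpow : ∀ x (n : ℕ), Q x → Q (x ^ n) := by
    intro x n hxd
    induction n with
    | zero => simpa using hmono 0 1 (one_mem _)
    | succ n ih =>
      rw [pow_succ]
      exact hmul _ _ ih hxd
  induction hx using adjoin_induction with
  | mem x hx =>
    rw [Set.mem_singleton_iff] at hx
    subst hx
    simpa using hmono 1 1 (one_mem _)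
  | algebraMap c =>
    have h := hmono 0 (algebraMap k K ((frobeniusEquiv k p).symm c))
      (IntermediateField.algebraMap_mem _ _)
    rwa [pow_zero, one_mul, ← map_pow, frobeniusEquiv_symm_pow_p] at h
  | add x y _ _ hx hy => exact hadd x y hx hy
  | inv x hxm hx =>
    rw [inv_eq_pow_mul_inv_pow x hp.one_le]
    exact hscale _ _ (inv_mem hxm) (hpow x (p - 1) hx)
  | mul x y _ _ hx hy => exact hmul x y hx hy

/-! ## Mac Lane's criterion for `K / k(t)` -/

/-- **`K / k(t)` preserves linear independence under `p`-th powers when `t ∉ K^p`** (`k` perfect of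
characteristic `p`): if `x₁, …, xₘ ∈ K` are `k(t)`-linearly independent then so are
`x₁^p, …, xₘ^p`. Write the coefficients of a relation as `c_x = ∑_j t^j d_{xj}^p`; then
`∑_j t^j (∑_x d_{xj} x)^p = 0`, so every `∑_x d_{xj} x` vanishes, so every `d_{xj}` does.
[folklore] -/
theorem linearIndepOn_pow_of_forall_pow_ne {k K : Type*} [Field k] [Field K] [Algebra k K] {p : ℕ}
    (hp : p.Prime) [CharP k p] [PerfectField k] {t : K} (hnp : ∀ u : K, u ^ p ≠ t)
    (s : Finset K) (hs : LinearIndepOn k⟮t⟯ _root_.id (s : Set K)) :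
    LinearIndepOn k⟮t⟯ (· ^ p) (s : Set K) := by
  haveI : CharP K p := charP_of_injective_algebraMap (algebraMap k K).injective p
  haveI : ExpChar K p := ExpChar.prime hp
  unfold LinearIndepOn at hs ⊢
  rw [linearIndependent_iff'] at hs ⊢
  intro S g hsum i hi
  choose d hdmem hd using fun x : ↥(s : Set K) => exists_eq_sum_pow_mul_pow hp t (g x).2
  have hsum' : ∑ j : Fin p, t ^ (j : ℕ) * (∑ x ∈ S, d x j * (x : K)) ^ p = 0 := by
    rw [← hsum]
    simp_rw [sum_pow_char p, Finset.mul_sum]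
    rw [Finset.sum_comm]
    refine Finset.sum_congr rfl fun x _ => ?_
    rw [Algebra.smul_def, show algebraMap (↥k⟮t⟯) K (g x) = (g x : K) from rfl, hd x,
      Finset.sum_mul]
    refine Finset.sum_congr rfl fun j _ => ?_
    show t ^ (j : ℕ) * (d x j * (x : K)) ^ p = t ^ (j : ℕ) * d x j ^ p * (x : K) ^ p
    rw [mul_pow]
    ring
  have hzero := eq_zero_of_sum_pow_mul_pow_eq_zero hp hnp _ hsum'
  have hd0 : ∀ j, ∀ x ∈ S, d x j = 0 := by
    intro j x hx
    have h := hs S (fun y => ⟨d y j, hdmem y j⟩) ?_ x hx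
    · simpa using congrArg Subtype.val h
    · rw [← hzero j]
      refine Finset.sum_congr rfl fun y _ => ?_
      rw [Algebra.smul_def]
      rfl
  apply Subtype.ext
  rw [hd i]
  simp [hd0 _ i hi, hp.ne_zero]

/-! ## Separating transcendence bases inside a prescribed inversion-closed set -/

/-- Constrained version of Mathlib's
`IntermediateField.exists_finset_maximalFor_isTranscendenceBasis_separableClosure`: among the
finite transcendence bases lying in a given set `O` (assumed to contain one) there is one whose
separable closure is maximal (minimise the finite inseparable degree). [folklore] -/
theorem exists_finset_maximalFor_isTranscendenceBasis_subset {F E : Type*} [Field F] [Field E]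
    [Algebra F E] [Algebra.EssFiniteType F E] (O : Set E)
    (hne : ∃ s : Finset E, IsTranscendenceBasis F ((↑) : s → E) ∧ (↑s : Set E) ⊆ O) :
    ∃ s : Finset E, MaximalFor (fun u : Set E ↦ IsTranscendenceBasis F ((↑) : u → E) ∧ u ⊆ O)
      (fun u ↦ (separableClosure (adjoin F u) E).restrictScalars F) (s : Set E) := by
  let d (s : Finset E) := Field.finInsepDegree (adjoin F (s : Set E)) E
  have Hexists :
      {s : Finset E | IsTranscendenceBasis F ((↑) : s → E) ∧ (↑s : Set E) ⊆ O}.Nonempty := hne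
  let s := d.argminOn _ Hexists
  have hs := d.argminOn_mem _ Hexists
  refine ⟨s, hs, fun u hu ↦ not_lt_iff_le_imp_ge.mp fun H ↦ ?_⟩
  have hfin : u.Finite := by
    simp [Set.Finite, ← Cardinal.mk_lt_aleph0_iff, hu.1.cardinalMk_eq hs.1,
      Cardinal.natCast_lt_aleph0]
  lift u to Finset E using hfin
  have : Module.Finite (adjoin F (s : Set E)) E := by
    apply +allowSynthFailures Algebra.finite_of_essFiniteType_of_isAlgebraic
    · exact .of_comp F _ _
    · convert! hs.1.isAlgebraic_field <;> simp [s]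
  have : Module.Finite ((separableClosure (adjoin F (s : Set E)) E).restrictScalars F) E :=
    inferInstanceAs <| Module.Finite (separableClosure (adjoin F (s : Set E)) E) E
  exact d.not_lt_argminOn _ hu (by apply finrank_lt_of_gt H)

/-- Constrained version of Mathlib's
`exists_isTranscendenceBasis_and_isSeparable_of_linearIndepOn_pow_of_essFiniteType`: under
Mac Lane's hypothesis on `p`-th powers, a finitely generated `E / F` has a SEPARATING
transcendence basis inside any set `O` which contains `x` or `x⁻¹` for every `x` and contains some
transcendence basis. (If `n` is inseparable over the maximal candidate `F(s)`, so is whichever of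
`n, n⁻¹` lies in `O`; exchanging it into `s` enlarges the separable closure.) [folklore] -/
theorem exists_isTranscendenceBasis_subset_and_isSeparable {F E : Type*} [Field F] [Field E]
    [Algebra F E] (p : ℕ) (hp : p.Prime) [ExpChar F p]
    (H : ∀ s : Finset E,
      LinearIndepOn F _root_.id (s : Set E) → LinearIndepOn F (· ^ p) (s : Set E))
    [Algebra.EssFiniteType F E] (O : Set E) (hO : ∀ x : E, x ∈ O ∨ x⁻¹ ∈ O)
    (hne : ∃ s : Finset E, IsTranscendenceBasis F ((↑) : s → E) ∧ (↑s : Set E) ⊆ O) :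
    ∃ s : Finset E, (↑s : Set E) ⊆ O ∧ IsTranscendenceBasis F ((↑) : s → E) ∧
      Algebra.IsSeparable (adjoin F (s : Set E)) E := by
  have ⟨s, ⟨hs, hsO⟩, Hs⟩ := exists_finset_maximalFor_isTranscendenceBasis_subset (F := F) O hne
  refine ⟨s, hsO, hs, ⟨fun m ↦ of_not_not fun hm' ↦ ?_⟩⟩
  have hm : m ∉ separableClosure (adjoin F (s : Set E)) E := fun h ↦
    hm' (mem_separableClosure_iff.mp h)
  obtain ⟨n, hnO, hn⟩ : ∃ n : E, n ∈ O ∧ n ∉ separableClosure (adjoin F (s : Set E)) E := by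
    rcases hO m with h | h
    · exact ⟨m, h, hm⟩
    · exact ⟨m⁻¹, h, fun h' ↦ hm (by simpa using inv_mem h')⟩
  have hns : n ∉ s := fun h ↦ hn (le_restrictScalars_separableClosure _ (subset_adjoin _ _ h))
  have ⟨i, hi₁, hi₂⟩ := exists_isTranscendenceBasis_and_isSeparable_of_linearIndepOn_pow'
    p hp (a := id) H s n hs hns
  rw [Set.image_id] at hi₂
  refine not_lt_iff_le_imp_ge.mpr (Hs ⟨hi₁, ?_⟩)
    (SetLike.lt_iff_le_and_exists.mpr ⟨?_, n, ?_, hn⟩)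
  · intro x hx
    rcases hx.1 with rfl | hx'
    · exact hnO
    · exact hsO hx'
  · rw [separableClosure_le_separableClosure_iff, adjoin_le_iff]
    intro x hx
    obtain rfl | ne := eq_or_ne x i
    exacts [hi₂, le_restrictScalars_separableClosure _ (subset_adjoin _ _ ⟨.inr hx, ne⟩)]
  · obtain rfl | ne := eq_or_ne n i
    exacts [hi₂, le_restrictScalars_separableClosure _ (subset_adjoin _ _ ⟨.inl rfl, ne⟩)]

/-! ## The step S1 -/

/-- An element which is not a `p`-th power is transcendental over a perfect subfield of
characteristic `p` (an algebraic element generates an algebraic, hence perfect, extension of `k`,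
in which it is a `p`-th power). [folklore] -/
theorem transcendental_of_forall_pow_ne {k K : Type*} [Field k] [Field K] [Algebra k K] {p : ℕ}
    (hp : p.Prime) [CharP k p] [PerfectField k] {t : K} (hnp : ∀ u : K, u ^ p ≠ t) :
    Transcendental k t := by
  intro halg
  haveI : CharP K p := charP_of_injective_algebraMap (algebraMap k K).injective p
  haveI : ExpChar K p := ExpChar.prime hp
  haveI : FiniteDimensional k k⟮t⟯ := adjoin.finiteDimensional halg.isIntegral
  haveI : Algebra.IsAlgebraic k k⟮t⟯ := Algebra.IsAlgebraic.of_finite k _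
  haveI : PerfectField k⟮t⟯ := Algebra.IsAlgebraic.perfectField k
  obtain ⟨u, hu⟩ := surjective_frobenius k⟮t⟯ p ⟨t, mem_adjoin_simple_self k t⟩
  exact hnp u (by simpa [frobenius_def] using congrArg Subtype.val hu)

/-- **S1: a separating transcendence basis inside `O` containing the uniformizer.** For `k` perfect
of characteristic `p`, `K / k` finitely generated, `O ⊆ K` a valuation ring and `t ∈ O` not a
`p`-th power in `K`, there is a finite `s ⊆ O`, `t ∉ s`, with `{t} ∪ s` algebraically independent
over `k` and `K` separable algebraic over `k(t, s)`. Mac Lane's criterion over `k(t)`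
(`linearIndepOn_pow_of_forall_pow_ne`) feeds Mathlib's exchange lemma
(`exists_isTranscendenceBasis_and_isSeparable_of_linearIndepOn_pow'`, Stacks 0H71), replayed
inside `O`. [folklore] -/
theorem stub_dr_sepBasis (p : ℕ) (hp : p.Prime) (k K : Type) [Field k] [CharP k p] [PerfectField k]
    [Field K] [Algebra k K] (hK : (⊤ : IntermediateField k K).FG) (O : ValuationSubring K)
    (hO : ∀ c : k, algebraMap k K c ∈ O) (t : K) (htO : t ∈ O) (hnp : ∀ u : K, u ^ p ≠ t) :
    ∃ s : Finset K, t ∉ s ∧ (∀ y ∈ s, y ∈ O) ∧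
      AlgebraicIndependent k ((↑) : ↥(insert t (↑s : Set K)) → K) ∧
      Algebra.IsSeparable ↥(IntermediateField.adjoin k (insert t (↑s : Set K))) K ∧
      Algebra.IsAlgebraic ↥(IntermediateField.adjoin k (insert t (↑s : Set K))) K := by
  classical
  have _hkO := hO -- standing hypotheses of the branch, not needed here (see module docstring)
  have _htO := htO
  haveI : CharP K p := charP_of_injective_algebraMap (algebraMap k K).injective p
  haveI : ExpChar K p := ExpChar.prime hp
  haveI : Algebra.EssFiniteType k K := IntermediateField.fg_top_iff.mp hK
  haveI : Algebra.EssFiniteType k⟮t⟯ K := Algebra.EssFiniteType.of_comp k k⟮t⟯ K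
  have httr : Transcendental k t := transcendental_of_forall_pow_ne hp hnp
  have htm : t ∈ k⟮t⟯ := mem_adjoin_simple_self k t
  -- a transcendence basis of `K / k(t)` inside `O`: invert the generators outside `O`
  have hne : ∃ s : Finset K, IsTranscendenceBasis k⟮t⟯ ((↑) : s → K) ∧ (↑s : Set K) ⊆ ↑O := by
    obtain ⟨g, hg⟩ := hK
    let f : K → K := fun x => if x ∈ O then x else x⁻¹
    have hfO : ∀ x, f x ∈ O := fun x => by
      by_cases hx : x ∈ O
      · simp [f, hx]
      · simpa [f, hx] using (O.mem_or_inv_mem x).resolve_left hx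
    have hfx : ∀ x, x = f x ∨ x = (f x)⁻¹ := fun x => by
      by_cases hx : x ∈ O <;> simp [f, hx]
    have hg'O : (↑(g.image f) : Set K) ⊆ ↑O := by
      intro x hx
      rw [Finset.coe_image] at hx
      obtain ⟨y, -, rfl⟩ := hx
      exact hfO y
    have hgg' : adjoin k (↑g : Set K) ≤ adjoin k (↑(g.image f) : Set K) := by
      rw [adjoin_le_iff]
      intro x hx
      have hfx' : f x ∈ adjoin k (↑(g.image f) : Set K) :=
        subset_adjoin k _ (by rw [Finset.coe_image]; exact ⟨x, hx, rfl⟩)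
      rcases hfx x with h | h
      · exact h ▸ hfx'
      · exact h ▸ inv_mem hfx'
    have htop : adjoin k⟮t⟯ (↑(g.image f) : Set K) = ⊤ := by
      apply restrictScalars_injective k
      rw [restrictScalars_top, eq_top_iff, ← hg]
      refine hgg'.trans ?_
      rw [adjoin_le_iff]
      exact subset_adjoin k⟮t⟯ _
    have : Algebra.IsAlgebraic (Algebra.adjoin k⟮t⟯ (↑(g.image f) : Set K)) K := by
      rw [← isAlgebraic_adjoin_iff_top, htop, Algebra.isAlgebraic_iff_isIntegral]
      exact Algebra.isIntegral_of_surjective topEquiv.surjective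
    obtain ⟨u, hug, hu⟩ := exists_isTranscendenceBasis_subset (R := k⟮t⟯) (↑(g.image f) : Set K)
    lift u to Finset K using (g.image f).finite_toSet.subset hug
    exact ⟨u, hu, hug.trans hg'O⟩
  have H : ∀ s : Finset K, LinearIndepOn k⟮t⟯ _root_.id (s : Set K) →
      LinearIndepOn k⟮t⟯ (· ^ p) (s : Set K) := linearIndepOn_pow_of_forall_pow_ne hp hnp
  have hO' : ∀ x : K, x ∈ (O : Set K) ∨ x⁻¹ ∈ (O : Set K) := fun x => O.mem_or_inv_mem x
  obtain ⟨s, hsO, hs, hsep⟩ :=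
    exists_isTranscendenceBasis_subset_and_isSeparable (F := k⟮t⟯) (E := K) p hp H _ hO' hne
  -- separability over `k(t)(s) = k(t, s)`
  have hsep' : Algebra.IsSeparable ↥(IntermediateField.adjoin k (insert t (↑s : Set K))) K := by
    have h : Algebra.IsSeparable ((adjoin k⟮t⟯ (s : Set K)).restrictScalars k) K := hsep
    rw [adjoin_adjoin_left, Set.singleton_union] at h
    exact h
  refine ⟨s, ?_, fun y hy => hsO (Finset.mem_coe.mpr hy), ?_, hsep', ?_⟩
  · -- `t ∉ s`: `t ∈ k(t)` is algebraic over `k(t)`, the members of `s` are not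
    exact fun hts => hs.1.transcendental ⟨t, hts⟩ (isAlgebraic_algebraMap (⟨t, htm⟩ : k⟮t⟯))
  · -- algebraic independence of `{t} ∪ s` over `k`: towers
    have h1 : AlgebraicIndependent k (fun _ : Unit => t) :=
      algebraicIndependent_unique_type_iff.mpr httr
    have h2 : AlgebraicIndependent k (Sum.elim ((↑) : s → K) (fun _ : Unit => t)) :=
      h1.sumElim_of_tower (S := k⟮t⟯) (by
        rintro _ ⟨_, rfl⟩
        exact ⟨⟨t, htm⟩, rfl⟩) hs.1
    refine h2.to_subtype_range' ?_
    rw [Set.Sum.elim_range, Set.range_const, Set.union_singleton]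
    simp
  · haveI := hsep'
    exact Algebra.IsSeparable.isAlgebraic _ K

end Summit.ResolutionOfSingularities.ResolutionOfSingularities.Theorems.IndSmoothBirth

end
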